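import Summits.QuantumFields.YangMills.Theorems.BalabanUVNodesN08AlphaEq324RowCumLetterModel
import Literature.MathematicalPhysics.QuantumFieldTheory.Balaban1983to89.B1Eq324BenfattoEq324Signed

/-!
# Route «BalabanUVNodes», Track-A DAG node N08 = [Balaban1985UV3] Thm 1 p. 257 ∕ Thm 2 p. 272 — THE (α)-SOCKET FOR THE CLASS ROAD's MEASURE-FREE (3.24)
# CONSUMER: the re-lettered (3.24) row `h324` of the edited (α) clauses (`…RowCumLetter.StepAlphaEq324CoreLTAt.h324` on the lane,
# `…RowAC.StepAlphaEq324CoreLTAtAC.h324` on the road of record), AT THE FREE LETTER, from the per-instance two-sided sandwich of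
# `B1Eq324BenfattoEq324Signed.eq324_of_sandwich_consts` for ANY presenting lattice-field measure, in [B10]'s currencies, under an (h, U)-dependent
# presentation of the step's fluctuation block

Cell `pub-ymgap`, seat `pub-ymgap-dag-n08-w4` gen 5 (WIDTH SEAT 4∕4 on N08; CLAIM-1∕INTENT-1 INBOX l.37113).  `bears_on: R4∕N08`; filed
`--supports stmt-QuantumFields-27364` (K1⁹, helper; jail key 20542, mis-key rule R463 (4)(a)).  THEOREMS ONLY (def-free, sorry-free, standard axioms);
dag-n08-d g14's `…Eq324Signed.eq324_of_sandwich_consts` (p627662 ✓) and this seat's gen 0∕2 socket (`…RowSocket.eq324_mono`, `…RowCumLetterModel.budget_le_vol ∕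
gk_rpow_six_add ∕ setIntegral_exp_map_eq ∕ cumulantOf_moments_map_eq`) consumed BY NAME.

WHY (dag-n08-d g14's located memo `HOME/pub-ymgap-dag-n08-d/N08-CLASS-ENTRY-LOCATED-g14.md` §2 (iii)–(iv), §3 (3): «(iii)+(iv) through n08-w4's socket (M)»).
The class road of seats n08-b∕-c∕-d∕-w5 (our class form of [BenfattoEtAl1978] §5 for the Gaussian field `μ_K` of a CLASS kernel) hands its conclusion over in ONE
agreed currency — the two-sided sandwich `exp(Σ − |I|·errTerm(…)(p(η))) ≤ ∫Π_Δχ̂_{p(η)} e^{H_J} dμ ≤ exp(Σ + |I|·errTerm(…)(p(η)))`, `Σ = cumulantSum μ H_J t` — and the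
measure-free consumer `eq324_of_sandwich_consts` turns it, for ANY measure `μ` on lattice fields and ANY instance `(s, I, J, a)` with `sup|coeff| ≤ c·η^σ`, into
`0 < ∫Π_Δχ̂_{p(η)} e^{H_J} dμ ∧ |log ∫ − Σ| ≤ C·η^κ·|I|`, `η₀, C` depending on the class constants `(t, b*, S, ρ₁…ρ₄, b₀, p₀, σ, c, κ)` alone.  Gen 2's socket
(`…RowCumLetterModel` §1–§5) did the letter∕currency∕volume∕transport bookkeeping for [2]'s MODEL `P̂₀` only.  This file does it for the CLASS hand-over shape, so that an
instantiation at [B10]'s data (the IDENT — class II, NODE 00 objects; NOT claimed here) plugs into the (α)-row with NO further (α)-side typing: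
* §1 `integral_cutoffBoltzmann_eq_setIntegral'` (any `d`); ★ `eq324Row_of_sandwich_consts` — ANY `μ`: `∃ η₀ C`, ∀ `η ≤ η₀`: `b* < p(η)` ∧ (∀ `μ s I J a`, smallness →
  lower → upper → `Eq324 (∫ z in smallFieldSet I (p η), e^{H_J z} ∂μ) (n ↦ ℰ_μᵀ(H_J; n)) t C η κ |I|`) — the FREE moment-cumulant letter of `μ` (`truncatedExp μ H_J`).
* §2 ★★ `eq324Row_of_sandwich_gk_vol` — [B10]'s CURRENCIES for a constants record `𝔠`: small parameter `η := g_k` (the running coupling), threshold `p(g_k) =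
  B10.pFun b₀ p₀ (S.gk k)` ((41)∕(58)), truncation `t := n̄`, rate `κ := 6 + 2κ₀ < σ(n̄+1)`, error `C·g_k^{6+2κ₀}·|I| = C·(Lᵏg₀²)^{3+κ₀}·|I|`, volume `|I| ≤ v·|T₁^{(k)}|`,
  `C·v ≤ Ca + Cc` ⇒ `Eq324 (…∂μ) (ℰ_μᵀ(H_J;·)) 𝔠.nbar (𝔠.Ca + 𝔠.Cc) (Lᵏ·S.g0sq) (3 + 𝔠.κ₀) (S.sites k)`, UNIFORMLY in `S, k`; `…_one` (σ = 1, `5 + 2κ₀ < n̄`);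
  `…_rec` (at the record's own `𝔠.b₀, 𝔠.p₀` of (7) p. 257 — the threshold `pFun 𝔠.b₀ 𝔠.p₀ (S.gk k)` the edition's `bound28` reads).
* §3 ★★ `eq324_box_of_latticePresentation` — ONE instance of the transport: if a block `(Fl, μ𝔖, box, V)` is PRESENTED by a lattice-field model, `μ𝔖 = μ.map Φ`,
  `Φ⁻¹' box = smallFieldSet I b`, `V ∘ Φ = H`, then `Eq324` for `(∫_{smallFieldSet I b} e^{H} dμ, ℰ_μᵀ(H;·))` IS `Eq324` for `(∫_{box} e^{V} dμ𝔖, free cumulants of V under μ𝔖)`;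
  `h324RowAt_freeLetter_of_latticePresentation` — the row at `𝔖`, per `(h, U)`, every datum `(μ, Φ, I, J, a, b)` allowed to depend on `(h, U)`.
* §4 ★★★ `exists_h324Row_freeLetter_of_classSandwich` — THE PLUG: `∃ η₀ C` from the CLASS constants and the record ALONE such that for EVERY lattice approximation `S`,
  tower data `𝔖`, run step `k` with `g_k ≤ η₀` and volume factor `v` with `C·v ≤ Ca + Cc`: `b* < p(g_k)`, and an (h, U)-dependent presentation of the block by
  members `μ h U` with the per-(h, U) sandwich at `b = p(g_k)`, `t = n̄` IN `eq324_of_sandwich_consts`'s LITERAL CURRENCY, coefficient smallness `≤ c₀·g_k^σ` and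
  `|I h U| ≤ v·|T₁^{(k)}|` give `∀ h U, Eq324 (∫ ω in (𝔖 k).box h, e^{(𝔖 k).𝒱 h U ω} ∂(𝔖 k).μ) (n ↦ cumulantOf (m ↦ ∫ ((𝔖 k).𝒱 h U ω)^m ∂(𝔖 k).μ) n) 𝔠.nbar (𝔠.Ca + 𝔠.Cc)
  (Lᵏ·S.g0sq) (3 + 𝔠.κ₀) (S.sites k)` — the field `StepAlphaEq324CoreLTAtAC.h324` (p607065) ∕ `StepAlphaEq324CoreLTAt.h324` (p597105) at the FREE letter, character for
  character; `…_of_forall_gt` (the sandwich supplied in knit form `∀ b > b*`); `…_rec_one` (record's `b₀, p₀`, σ = 1).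
HONEST SCOPE.  Hypothesis-shape bookkeeping (real arithmetic + change of variables over binder shapes): the sandwich, the presentation `(μ, Φ, I, J, a)` of B10's
`dμ_{C^{(k)}}(Ω_{k+1}, U_{k+1})` by class members and the class constants are HYPOTHESES — the IDENT (class II ∕ NODE 00), the N06 [B9] in-edges for coercivity∕decay, the
G3D-02 row `hG` at the free letter are NOT claimed; nothing of [Balaban1985UV3] ∕ [BenfattoEtAl1978] asserted or discharged; `PrintedUV3V` NOT proved; N08 NOT discharged;
count-neutral.  One finite 𝕋⁴ programme at fixed ε, d = 3 tori of [B10] inside the record, Bałaban AS PRINTED; nothing about d = 4 continuum limits, OS axioms, a mass gap or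
the Clay problem — R4 closes the conditional finite-𝕋⁴ rung `BalabanLadder.UV` only.

References: [Balaban1985UV3] T. Bałaban, CMP 102 (1985) 255–275 — (7) p. 257, (41) p. 266, (56)–(58) p. 270; [Balaban1982Higgs1] T. Bałaban, CMP 85 (1982) 603–636 — (3.24)
p. 616; [BenfattoEtAl1978] G. Benfatto et al., CMP 59 (1978) 143–166 — (2.7) p. 147, Lemma (4.5)–(4.7) p. 152, Remark 4 p. 153.
-/

noncomputable section

namespace Summit.QuantumFields.YangMills.Theorems.BalabanUVNodesN08AlphaEq324RowClassSocket

open MeasureTheory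
open scoped BigOperators Nat
open Literature.MathematicalPhysics.QuantumFieldTheory.Balaban1983to89
open Literature.MathematicalPhysics.QuantumFieldTheory.Balaban1983to89.B1Sect3Statements (Eq324)
open Literature.MathematicalPhysics.QuantumFieldTheory.Balaban1983to89.B1Eq324BenfattoLemma
  (Coef hamiltonian coefSup smallFieldSet cutoffBoltzmann truncatedExp cumulantSum errTerm measurableSet_smallFieldSet)
open Literature.MathematicalPhysics.QuantumFieldTheory.Balaban1983to89.B1Eq324BenfattoEq324Signed (eq324_of_sandwich_consts)
open Literature.MathematicalPhysics.QuantumFieldTheory.Balaban1983to89.B1Eq324CumulantTaylor (eq324_iff_abs_log_sub_le)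
open Literature.MathematicalPhysics.QuantumFieldTheory.Balaban1985CMP102.Setting
open Summit.QuantumFields.Balaban3D.Carriers
open Summit.QuantumFields.Balaban3D.Proofs.ScalesArithmetic (g0sq_pos L_pos sites_nonneg gk_pos)
open Summit.QuantumFields.Balaban3D.Proofs.Primitives (AlphaConsts)
open Summit.QuantumFields.Balaban3D.Proofs.GroupModelLieC (lieC)
open Summit.QuantumFields.YangMills.Theorems.BalabanUVNodesN08AlphaEq324RowSocket (eq324_mono)
open Summit.QuantumFields.YangMills.Theorems.BalabanUVNodesN08AlphaEq324RowCumLetterModel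
  (budget_le_vol gk_rpow_six_add setIntegral_exp_map_eq cumulantOf_moments_map_eq)
open Literature.Probability.LatticeModels (cumulantOf)

variable {L : ℕ}

/-! ## §1 The class road's measure-free consumer in `Eq324` form, at the FREE moment-cumulant letter of the presenting measure -/

section MeasureFree

variable {d : ℕ}

/-- `∫ Π_Δχ̂_Δ e^{H} dμ = ∫_{smallFieldSet I b} e^{H} dμ` for any measure on lattice fields over `ℤ^d` (`cutoffBoltzmann` is the indicator-weighted Boltzmann factor;
gen 2's `…RowCumLetterModel.integral_cutoffBoltzmann_eq_setIntegral` is the `d = 3` instance). [cite: BenfattoEtAl1978, (4.6)–(4.7) p.152] -/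
theorem integral_cutoffBoltzmann_eq_setIntegral' (μ : Measure ((Fin d → ℤ) → ℝ)) (H : ((Fin d → ℤ) → ℝ) → ℝ) (I : Finset (Fin d → ℤ)) (b : ℝ) :
    ∫ z, cutoffBoltzmann H I b z ∂μ = ∫ z in smallFieldSet I b, Real.exp (H z) ∂μ := by
  simp only [cutoffBoltzmann]
  exact integral_indicator (measurableSet_smallFieldSet I b)

/-- The [2]-letter is the free moment-cumulant letter, any dimension: `ℰ_μᵀ(H; n) = cumulantOf (m ↦ ∫ Hᵐ dμ) n` (definitional). [cite: BenfattoEtAl1978, (2.7) p.147] -/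
theorem truncatedExp_eq_cumulantOf' (μ : Measure ((Fin d → ℤ) → ℝ)) (H : ((Fin d → ℤ) → ℝ) → ℝ) (n : ℕ) :
    truncatedExp μ H n = cumulantOf (fun m => ∫ z, H z ^ m ∂μ) n := rfl

/-- ★ **THE CLASS ROAD's MEASURE-FREE (3.24) CONSUMER IN `Eq324` FORM.**  Given class constants `b*`, `S ≥ 0`, `ρ₁, ρ₂, ρ₃ > 0, ρ₄`, threshold parameters `b₀ > 0`,
`p₀ > 2∕3`, coupling power `σ > 0`, `c ≥ 0`, truncation order `t` and any exponent `0 < κ < σ(t+1)`: there are `η₀ ∈ (0, 1]`, `C ≥ 0` such that for every `η ∈ (0, η₀]`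
the threshold `p(η) = b₀(1 + log η⁻¹)^{p₀}` exceeds `b*`, and for EVERY measure `μ` on lattice fields, every `s, I, J` and every coefficient family with `sup|coeff| ≤ c·η^σ`
the two-sided sandwich at `b = p(η)` (in `eq324_of_sandwich_consts`'s literal currency) implies
`Eq324 (∫ z in smallFieldSet I (p η), e^{H_J z} ∂μ) (n ↦ ℰ_μᵀ(H_J; n)) t C η κ |I|` — [B1] (3.24) in `η`-currency with the FREE truncated expectations of `μ` as the
cumulant letter.  (`eq324_of_sandwich_consts` + `B1Eq324CumulantTaylor.eq324_iff_abs_log_sub_le`; `cumulantSum μ H t = Σ_{n=1}^{t} ℰ_μᵀ(H; n)∕n!` by definition.)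
[cite: Balaban1982Higgs1, (3.24) p.616; BenfattoEtAl1978, Lemma (4.6)–(4.7) p.152, Remark 4 p.153] -/
theorem eq324Row_of_sandwich_consts {t D : ℕ} {ϰ bstar Sc ρ₁ ρ₂ ρ₃ ρ₄ b₀ p₀ σ c κ : ℝ}
    (hS : 0 ≤ Sc) (hρ₃ : 0 < ρ₃) (hb₀ : 0 < b₀) (hp₀ : 2 / 3 < p₀) (hσ : 0 < σ) (hc : 0 ≤ c) (hκ : 0 < κ) (hκσ : κ < σ * (t + 1)) :
    ∃ η₀ C : ℝ, 0 < η₀ ∧ η₀ ≤ 1 ∧ 0 ≤ C ∧ ∀ η : ℝ, 0 < η → η ≤ η₀ →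
      bstar < B10.pFun b₀ p₀ η ∧
      ∀ (μ : Measure ((Fin d → ℤ) → ℝ)) (s : ℕ) (I J : Finset (Fin d → ℤ)) (a : Coef d), coefSup s D a J ≤ c * η ^ σ →
        Real.exp (cumulantSum μ (hamiltonian s D ϰ a J) t -
              (I.card : ℝ) * errTerm Sc ρ₁ ρ₂ ρ₃ ρ₄ (coefSup s D a J) (B10.pFun b₀ p₀ η) t) ≤
            ∫ z, cutoffBoltzmann (hamiltonian s D ϰ a J) I (B10.pFun b₀ p₀ η) z ∂μ →
        ∫ z, cutoffBoltzmann (hamiltonian s D ϰ a J) I (B10.pFun b₀ p₀ η) z ∂μ ≤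
            Real.exp (cumulantSum μ (hamiltonian s D ϰ a J) t +
              (I.card : ℝ) * errTerm Sc ρ₁ ρ₂ ρ₃ ρ₄ (coefSup s D a J) (B10.pFun b₀ p₀ η) t) →
        Eq324 (∫ z in smallFieldSet I (B10.pFun b₀ p₀ η), Real.exp (hamiltonian s D ϰ a J z) ∂μ)
          (fun n => truncatedExp μ (hamiltonian s D ϰ a J) n) t C η κ I.card := by
  obtain ⟨η₀, C, hη₀, hη₀1, hC, h⟩ :=
    eq324_of_sandwich_consts (d := d) (D := D) (ϰ := ϰ) (bstar := bstar) (ρ₁ := ρ₁) (ρ₂ := ρ₂) (ρ₄ := ρ₄)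
      hS hρ₃ hb₀ hp₀ hσ hc hκ hκσ
  refine ⟨η₀, C, hη₀, hη₀1, hC, fun η hη hηle => ?_⟩
  obtain ⟨hb, hE⟩ := h η hη hηle
  refine ⟨hb, fun μ s I J a hA hlow hup => ?_⟩
  obtain ⟨hpos, habs⟩ := hE μ s I J a hA hlow hup
  rw [integral_cutoffBoltzmann_eq_setIntegral'] at hpos habs
  rw [eq324_iff_abs_log_sub_le hpos]
  simpa only [cumulantSum] using habs

end MeasureFree

/-! ## §2 … in [B10]'s currencies: `η := g_k`, threshold `p(g_k)`, `t := n̄`, rate `6 + 2κ₀`, the record's booked budget `(Ca + Cc)·(Lᵏg₀²)^{3+κ₀}·|T₁^{(k)}|`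
with a volume factor -/

section Coupling

variable {N : ℕ} (𝔠 : AlphaConsts L N) {d : ℕ}

/-- ★★ **THE CLASS CONSUMER AT [B10]'s CURRENCIES, ANY PRESENTING MEASURE.**  Small parameter `η := g_k = S.gk k` (the running coupling), small-field threshold
`p(g_k) = B10.pFun b₀ p₀ (S.gk k)` (print's (41)∕(58)), coefficients `≤ c₀·g_k^σ` with `6 + 2κ₀ < σ(n̄ + 1)`, truncation `t := 𝔠.nbar`.  With `η₀, C` depending on the
class constants and on `n̄, κ₀, σ` only: for every lattice approximation `S`, every step `k` with `g_k ≤ η₀` and every volume factor `v` with `C·v ≤ Ca + Cc`,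
the threshold exceeds `b*`, and for EVERY measure `μ` on lattice fields and every instance `(s, I, J, a)` with `|I| ≤ v·|T₁^{(k)}|`, the sandwich at `b = p(g_k)` gives
`Eq324 (∫ z in smallFieldSet I (p(g_k)), e^{H_J z} ∂μ) (n ↦ ℰ_μᵀ(H_J; n)) 𝔠.nbar (𝔠.Ca + 𝔠.Cc) (Lᵏ·S.g0sq) (3 + 𝔠.κ₀) (S.sites k)` — literally the right-hand currencies of
`…RowAC.StepAlphaEq324CoreLTAtAC.h324` ∕ `…RowCumLetter.StepAlphaEq324CoreLTAt.h324` (`g_k^{6+2κ₀} = (Lᵏg₀²)^{3+κ₀}`: gen 2's `gk_rpow_six_add`; budget: `budget_le_vol`).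
[cite: Balaban1985UV3, (41) p.266 + (56)–(58) p.270; Balaban1982Higgs1, (3.24) p.616; BenfattoEtAl1978, Lemma p.152, Remark 4 p.153] -/
theorem eq324Row_of_sandwich_gk_vol {D : ℕ} {ϰ bstar Sc ρ₁ ρ₂ ρ₃ ρ₄ b₀ p₀ σ c₀ : ℝ}
    (hS : 0 ≤ Sc) (hρ₃ : 0 < ρ₃) (hb₀ : 0 < b₀) (hp₀ : 2 / 3 < p₀) (hσ : 0 < σ) (hc₀ : 0 ≤ c₀) (hκσ : 6 + 2 * 𝔠.κ₀ < σ * (𝔠.nbar + 1)) :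
    ∃ η₀ C : ℝ, 0 < η₀ ∧ η₀ ≤ 1 ∧ 0 ≤ C ∧ ∀ (S : Scales L) (k : ℕ) (v : ℝ), S.gk k ≤ η₀ → C * v ≤ 𝔠.Ca + 𝔠.Cc →
      bstar < B10.pFun b₀ p₀ (S.gk k) ∧
      ∀ (μ : Measure ((Fin d → ℤ) → ℝ)) (s : ℕ) (I J : Finset (Fin d → ℤ)) (a : Coef d),
        coefSup s D a J ≤ c₀ * S.gk k ^ σ → (I.card : ℝ) ≤ v * S.sites k →
        Real.exp (cumulantSum μ (hamiltonian s D ϰ a J) 𝔠.nbar -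
              (I.card : ℝ) * errTerm Sc ρ₁ ρ₂ ρ₃ ρ₄ (coefSup s D a J) (B10.pFun b₀ p₀ (S.gk k)) 𝔠.nbar) ≤
            ∫ z, cutoffBoltzmann (hamiltonian s D ϰ a J) I (B10.pFun b₀ p₀ (S.gk k)) z ∂μ →
        ∫ z, cutoffBoltzmann (hamiltonian s D ϰ a J) I (B10.pFun b₀ p₀ (S.gk k)) z ∂μ ≤
            Real.exp (cumulantSum μ (hamiltonian s D ϰ a J) 𝔠.nbar +
              (I.card : ℝ) * errTerm Sc ρ₁ ρ₂ ρ₃ ρ₄ (coefSup s D a J) (B10.pFun b₀ p₀ (S.gk k)) 𝔠.nbar) →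
        Eq324 (∫ z in smallFieldSet I (B10.pFun b₀ p₀ (S.gk k)), Real.exp (hamiltonian s D ϰ a J z) ∂μ)
          (fun n => truncatedExp μ (hamiltonian s D ϰ a J) n) 𝔠.nbar (𝔠.Ca + 𝔠.Cc) ((L : ℝ) ^ k * S.g0sq) (3 + 𝔠.κ₀) (S.sites k) := by
  obtain ⟨η₀, C, hη₀, hη₀1, hC, h⟩ :=
    eq324Row_of_sandwich_consts (d := d) (t := 𝔠.nbar) (D := D) (ϰ := ϰ) (bstar := bstar) (ρ₁ := ρ₁) (ρ₂ := ρ₂) (ρ₄ := ρ₄)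
      (κ := 6 + 2 * 𝔠.κ₀) hS hρ₃ hb₀ hp₀ hσ hc₀ (by linarith [𝔠.κ₀_pos]) hκσ
  refine ⟨η₀, C, hη₀, hη₀1, hC, fun S k v hgk hCv => ?_⟩
  have hg : 0 < S.gk k := gk_pos S k
  obtain ⟨hb, hE⟩ := h (S.gk k) hg hgk
  refine ⟨hb, fun μ s I J a hA hI hlow hup => ?_⟩
  refine eq324_mono (hE μ s I J a hA hlow hup) ?_
  rw [gk_rpow_six_add]
  exact budget_le_vol hC (mul_pos (pow_pos (L_pos S) k) (g0sq_pos S)) (sites_nonneg S k) hI hCv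

/-- **… at print's coupling power `σ = 1`** (effective-potential coefficients `O(g_k)`, (56)–(57)): available whenever `5 + 2κ₀ < n̄` — so `n̄ = 6` («up to the sixth
order») serves every record (`κ₀ < ½`, gen 2's `five_add_two_mul_κ₀_lt_six`). [cite: Balaban1985UV3, p.261 + (56)–(58) p.270; BenfattoEtAl1978, Lemma p.152] -/
theorem eq324Row_of_sandwich_gk_vol_one {D : ℕ} {ϰ bstar Sc ρ₁ ρ₂ ρ₃ ρ₄ b₀ p₀ c₀ : ℝ}
    (hS : 0 ≤ Sc) (hρ₃ : 0 < ρ₃) (hb₀ : 0 < b₀) (hp₀ : 2 / 3 < p₀) (hc₀ : 0 ≤ c₀) (hn : 5 + 2 * 𝔠.κ₀ < 𝔠.nbar) :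
    ∃ η₀ C : ℝ, 0 < η₀ ∧ η₀ ≤ 1 ∧ 0 ≤ C ∧ ∀ (S : Scales L) (k : ℕ) (v : ℝ), S.gk k ≤ η₀ → C * v ≤ 𝔠.Ca + 𝔠.Cc →
      bstar < B10.pFun b₀ p₀ (S.gk k) ∧
      ∀ (μ : Measure ((Fin d → ℤ) → ℝ)) (s : ℕ) (I J : Finset (Fin d → ℤ)) (a : Coef d),
        coefSup s D a J ≤ c₀ * S.gk k → (I.card : ℝ) ≤ v * S.sites k →
        Real.exp (cumulantSum μ (hamiltonian s D ϰ a J) 𝔠.nbar -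
              (I.card : ℝ) * errTerm Sc ρ₁ ρ₂ ρ₃ ρ₄ (coefSup s D a J) (B10.pFun b₀ p₀ (S.gk k)) 𝔠.nbar) ≤
            ∫ z, cutoffBoltzmann (hamiltonian s D ϰ a J) I (B10.pFun b₀ p₀ (S.gk k)) z ∂μ →
        ∫ z, cutoffBoltzmann (hamiltonian s D ϰ a J) I (B10.pFun b₀ p₀ (S.gk k)) z ∂μ ≤
            Real.exp (cumulantSum μ (hamiltonian s D ϰ a J) 𝔠.nbar +
              (I.card : ℝ) * errTerm Sc ρ₁ ρ₂ ρ₃ ρ₄ (coefSup s D a J) (B10.pFun b₀ p₀ (S.gk k)) 𝔠.nbar) →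
        Eq324 (∫ z in smallFieldSet I (B10.pFun b₀ p₀ (S.gk k)), Real.exp (hamiltonian s D ϰ a J z) ∂μ)
          (fun n => truncatedExp μ (hamiltonian s D ϰ a J) n) 𝔠.nbar (𝔠.Ca + 𝔠.Cc) ((L : ℝ) ^ k * S.g0sq) (3 + 𝔠.κ₀) (S.sites k) := by
  obtain ⟨η₀, C, hη₀, hη₀1, hC, h⟩ :=
    eq324Row_of_sandwich_gk_vol 𝔠 (d := d) (D := D) (ϰ := ϰ) (bstar := bstar) (ρ₁ := ρ₁) (ρ₂ := ρ₂) (ρ₄ := ρ₄)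
      (σ := 1) hS hρ₃ hb₀ hp₀ one_pos hc₀ (by linarith)
  refine ⟨η₀, C, hη₀, hη₀1, hC, fun S k v hgk hCv => ?_⟩
  obtain ⟨hb, hE⟩ := h S k v hgk hCv
  exact ⟨hb, fun μ s I J a hA hI hlow hup => hE μ s I J a (by rwa [Real.rpow_one]) hI hlow hup⟩

/-- **… at the RECORD's own threshold parameters `b₀ = 𝔠.b₀`, `p₀ = 𝔠.p₀`** ((7) p. 257: `b₀` «sufficiently large», `p₀ > 2` — `AlphaConsts.b₀_pos`, `two_lt_p₀`), σ = 1: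
the small-field threshold is then `B10.pFun 𝔠.b₀ 𝔠.p₀ (S.gk k)`, the very function the edition's `bound28` reads.
[cite: Balaban1985UV3, (7) p.257 + (41) p.266 + (58) p.270; BenfattoEtAl1978, Lemma p.152] -/
theorem eq324Row_of_sandwich_gk_vol_rec {D : ℕ} {ϰ bstar Sc ρ₁ ρ₂ ρ₃ ρ₄ c₀ : ℝ}
    (hS : 0 ≤ Sc) (hρ₃ : 0 < ρ₃) (hc₀ : 0 ≤ c₀) (hn : 5 + 2 * 𝔠.κ₀ < 𝔠.nbar) :
    ∃ η₀ C : ℝ, 0 < η₀ ∧ η₀ ≤ 1 ∧ 0 ≤ C ∧ ∀ (S : Scales L) (k : ℕ) (v : ℝ), S.gk k ≤ η₀ → C * v ≤ 𝔠.Ca + 𝔠.Cc →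
      bstar < B10.pFun 𝔠.b₀ 𝔠.p₀ (S.gk k) ∧
      ∀ (μ : Measure ((Fin d → ℤ) → ℝ)) (s : ℕ) (I J : Finset (Fin d → ℤ)) (a : Coef d),
        coefSup s D a J ≤ c₀ * S.gk k → (I.card : ℝ) ≤ v * S.sites k →
        Real.exp (cumulantSum μ (hamiltonian s D ϰ a J) 𝔠.nbar -
              (I.card : ℝ) * errTerm Sc ρ₁ ρ₂ ρ₃ ρ₄ (coefSup s D a J) (B10.pFun 𝔠.b₀ 𝔠.p₀ (S.gk k)) 𝔠.nbar) ≤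
            ∫ z, cutoffBoltzmann (hamiltonian s D ϰ a J) I (B10.pFun 𝔠.b₀ 𝔠.p₀ (S.gk k)) z ∂μ →
        ∫ z, cutoffBoltzmann (hamiltonian s D ϰ a J) I (B10.pFun 𝔠.b₀ 𝔠.p₀ (S.gk k)) z ∂μ ≤
            Real.exp (cumulantSum μ (hamiltonian s D ϰ a J) 𝔠.nbar +
              (I.card : ℝ) * errTerm Sc ρ₁ ρ₂ ρ₃ ρ₄ (coefSup s D a J) (B10.pFun 𝔠.b₀ 𝔠.p₀ (S.gk k)) 𝔠.nbar) →
        Eq324 (∫ z in smallFieldSet I (B10.pFun 𝔠.b₀ 𝔠.p₀ (S.gk k)), Real.exp (hamiltonian s D ϰ a J z) ∂μ)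
          (fun n => truncatedExp μ (hamiltonian s D ϰ a J) n) 𝔠.nbar (𝔠.Ca + 𝔠.Cc) ((L : ℝ) ^ k * S.g0sq) (3 + 𝔠.κ₀) (S.sites k) :=
  eq324Row_of_sandwich_gk_vol_one 𝔠 (b₀ := 𝔠.b₀) (p₀ := 𝔠.p₀) hS hρ₃ 𝔠.b₀_pos (by linarith [𝔠.two_lt_p₀]) hc₀ hn

end Coupling

/-! ## §3 Transport under a presentation of the step's fluctuation block by a lattice-field model -/

section Presentation

variable {d : ℕ}

/-- ★★ **ONE INSTANCE OF THE TRANSPORT.**  If a fluctuation block `(Fl, μ𝔖, box, V)` is PRESENTED by a lattice-field model — `μ𝔖 = μ.map Φ` with `Φ` measurable, the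
box pulling back to a small-field set `Φ⁻¹' box = smallFieldSet I b`, the potential pulling back to a (4.5)-type Hamiltonian `V ∘ Φ = H` — then the `Eq324` statement for
`(∫_{smallFieldSet I b} e^{H} dμ, ℰ_μᵀ(H; ·))` (§1–§2's conclusion at `μ`) IS the `Eq324` statement for `(∫_{box} e^{V} dμ𝔖, free moment-cumulants of V under μ𝔖)`, same
constants (change of variables `setIntegral_exp_map_eq` + `cumulantOf_moments_map_eq`).
[cite: Balaban1985UV3, (58) p.270; Balaban1982Higgs1, (3.24) p.616; BenfattoEtAl1978, (2.7) p.147 (bookkeeping)] -/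
theorem eq324_box_of_latticePresentation {Fl : Type*} [MeasurableSpace Fl] {μ𝔖 : Measure Fl} {box : Set Fl} {V : Fl → ℝ}
    (μ : Measure ((Fin d → ℤ) → ℝ)) {Φ : ((Fin d → ℤ) → ℝ) → Fl} (hΦ : Measurable Φ) (hμ : μ𝔖 = μ.map Φ) (hboxm : MeasurableSet box) (hVm : Measurable V)
    {I : Finset (Fin d → ℤ)} {b : ℝ} (hbox : Φ ⁻¹' box = smallFieldSet I b) {H : ((Fin d → ℤ) → ℝ) → ℝ} (hV : ∀ z, V (Φ z) = H z)
    {nbar : ℕ} {C₂ sc κ vol : ℝ} (h : Eq324 (∫ z in smallFieldSet I b, Real.exp (H z) ∂μ) (fun n => truncatedExp μ H n) nbar C₂ sc κ vol) :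
    Eq324 (∫ ω in box, Real.exp (V ω) ∂μ𝔖) (fun n => cumulantOf (fun m => ∫ ω, V ω ^ m ∂μ𝔖) n) nbar C₂ sc κ vol := by
  obtain rfl : H = fun z => V (Φ z) := (funext hV).symm
  subst hμ
  rw [setIntegral_exp_map_eq μ hΦ hboxm hVm, hbox]
  have hc : (fun n => cumulantOf (fun m => ∫ ω, V ω ^ m ∂(μ.map Φ)) n) = fun n => truncatedExp μ (fun z => V (Φ z)) n := by
    funext n
    rw [cumulantOf_moments_map_eq μ hΦ hVm n, truncatedExp_eq_cumulantOf']
  rw [hc]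
  exact h

variable {S : Scales L} {G : Type} [GaugeGroup G] [MeasurableSpace G] [HaarData G] (𝔊 : GroupModel G) (𝔠 : AlphaConsts L 𝔊.N)
  (𝔖 : ∀ k, StepSeries S G ↥(lieC 𝔊) (nblkOf S 𝔠.lane.carrier k) k) (k : ℕ)

/-- **THE RE-LETTERED (3.24) ROW AT `𝔖`'s FREE LETTER FROM A LATTICE PRESENTATION, per `(h, U)`** — every presenting datum (the member `μ h U`, the map `Φ h U`, the
cut-off set `I h U`, the threshold `b h U`, the Hamiltonian `H h U`) may depend on the history AND the field: from `(𝔖 k).μ = (μ h U).map (Φ h U)`,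
`(Φ h U)⁻¹'((𝔖 k).box h) = smallFieldSet (I h U) (b h U)`, `(𝔖 k).𝒱 h U ∘ Φ h U = H h U` and the per-(h, U) `Eq324` statements at `μ h U`, the row
`∀ h U, Eq324 (∫ ω in (𝔖 k).box h, e^{(𝔖 k).𝒱 h U ω} ∂(𝔖 k).μ) (n ↦ cumulantOf (m ↦ ∫ ((𝔖 k).𝒱 h U ω)^m ∂(𝔖 k).μ) n) 𝔠.nbar C₂ sc κ vol` (any constants).
[cite: Balaban1985UV3, (58) p.270; Balaban1982Higgs1, (3.24) p.616] -/
theorem h324RowAt_freeLetter_of_latticePresentation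
    (μ : Hist S.P (k + 1) → GaugeField S.P (k + 1) G → Measure ((Fin d → ℤ) → ℝ))
    (Φ : Hist S.P (k + 1) → GaugeField S.P (k + 1) G → ((Fin d → ℤ) → ℝ) → (𝔖 k).Fl) (hΦ : ∀ h U, Measurable (Φ h U))
    (hμ : ∀ h U, (𝔖 k).μ = (μ h U).map (Φ h U)) (hboxm : ∀ h, MeasurableSet ((𝔖 k).box h)) (hVm : ∀ h U, Measurable ((𝔖 k).𝒱 h U))
    (I : Hist S.P (k + 1) → GaugeField S.P (k + 1) G → Finset (Fin d → ℤ)) (b : Hist S.P (k + 1) → GaugeField S.P (k + 1) G → ℝ)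
    (hbox : ∀ h U, Φ h U ⁻¹' (𝔖 k).box h = smallFieldSet (I h U) (b h U))
    (H : Hist S.P (k + 1) → GaugeField S.P (k + 1) G → ((Fin d → ℤ) → ℝ) → ℝ) (hV : ∀ h U z, (𝔖 k).𝒱 h U (Φ h U z) = H h U z) {C₂ sc κ vol : ℝ}
    (h324' : ∀ h U, Eq324 (∫ z in smallFieldSet (I h U) (b h U), Real.exp (H h U z) ∂μ h U) (fun n => truncatedExp (μ h U) (H h U) n) 𝔠.nbar C₂ sc κ vol) :
    ∀ h (U : GaugeField S.P (k + 1) G), Eq324 (∫ ω in (𝔖 k).box h, Real.exp ((𝔖 k).𝒱 h U ω) ∂(𝔖 k).μ)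
      (fun n => cumulantOf (fun m => ∫ ω, (𝔖 k).𝒱 h U ω ^ m ∂(𝔖 k).μ) n) 𝔠.nbar C₂ sc κ vol :=
  fun h U => eq324_box_of_latticePresentation (μ h U) (hΦ h U) (hμ h U) (hboxm h) (hVm h U) (hbox h U) (hV h U) (h324' h U)

end Presentation

/-! ## §4 THE PLUG: the class road's sandwich, at [B10]'s currencies, under a presentation ⟹ the `h324` field of the edited clauses at the FREE letter -/

section Plug

variable {G : Type} [GaugeGroup G] [MeasurableSpace G] [HaarData G] (𝔊 : GroupModel G) (𝔠 : AlphaConsts L 𝔊.N) {d : ℕ}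

/-- ★★★ **THE (α)-ROW `h324` OF THE EDITED CLAUSES FROM THE CLASS ROAD's SANDWICH, UNIFORMLY IN THE LATTICE APPROXIMATION.**  Fix a group model and a constants record `𝔠`,
class constants `b*`, `S ≥ 0`, `ρ₁, ρ₂, ρ₃ > 0, ρ₄`, `(D, ϰ)`, threshold parameters `b₀ > 0`, `p₀ > 2∕3`, coupling power `σ` with `6 + 2κ₀ < σ(n̄ + 1)`, `c₀ ≥ 0`.  There are
`η₀ ∈ (0, 1]` and `C ≥ 0` — depending on these alone — such that for EVERY lattice approximation `S`, tower data `𝔖`, run step `k` with `g_k ≤ η₀` and volume factor `v` with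
`C·v ≤ Ca + Cc`: (a) `b* < p(g_k)`; (b) whenever the step's fluctuation block is PRESENTED, per `(h, U)`, by a lattice-field member `μ h U` — `(𝔖 k).μ = (μ h U).map (Φ h U)`,
`(Φ h U)⁻¹'(box h) = smallFieldSet (I h U) (p(g_k))`, `𝒱 h U ∘ Φ h U = H_{J h U}` with coefficients `a h U`, `sup|coeff| ≤ c₀·g_k^σ`, `|I h U| ≤ v·|T₁^{(k)}|` — and the member
satisfies the two-sided sandwich at `b = p(g_k)`, `t = n̄` (in `eq324_of_sandwich_consts`'s literal currency), then
`∀ h U, Eq324 (∫ ω in (𝔖 k).box h, e^{(𝔖 k).𝒱 h U ω} ∂(𝔖 k).μ) (n ↦ cumulantOf (m ↦ ∫ ((𝔖 k).𝒱 h U ω)^m ∂(𝔖 k).μ) n) 𝔠.nbar (𝔠.Ca + 𝔠.Cc) (Lᵏ·S.g0sq) (3 + 𝔠.κ₀) (S.sites k)`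
— the field `…RowAC.StepAlphaEq324CoreLTAtAC.h324` (road of record) ∕ `…RowCumLetter.StepAlphaEq324CoreLTAt.h324` (lane) at the free letter
`c k h U n := cumulantOf (m ↦ ∫ (𝒱 h U)ᵐ d(𝔖 k).μ) n`, character for character.  (§2 + §3.)  The presentation and the sandwich are HYPOTHESES (the IDENT, class II).
[cite: Balaban1985UV3, (41) p.266 + (56)–(58) p.270; Balaban1982Higgs1, (3.24) p.616; BenfattoEtAl1978, (2.7) p.147 + Lemma (4.6)–(4.7) p.152 + Remark 4 p.153] -/
theorem exists_h324Row_freeLetter_of_classSandwich {D : ℕ} {ϰ bstar Sc ρ₁ ρ₂ ρ₃ ρ₄ b₀ p₀ σ c₀ : ℝ}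
    (hS : 0 ≤ Sc) (hρ₃ : 0 < ρ₃) (hb₀ : 0 < b₀) (hp₀ : 2 / 3 < p₀) (hσ : 0 < σ) (hc₀ : 0 ≤ c₀) (hκσ : 6 + 2 * 𝔠.κ₀ < σ * (𝔠.nbar + 1)) :
    ∃ η₀ C : ℝ, 0 < η₀ ∧ η₀ ≤ 1 ∧ 0 ≤ C ∧
      ∀ (S : Scales L) (𝔖 : ∀ k, StepSeries S G ↥(lieC 𝔊) (nblkOf S 𝔠.lane.carrier k) k) (k : ℕ) (v : ℝ),
        S.gk k ≤ η₀ → C * v ≤ 𝔠.Ca + 𝔠.Cc →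
        bstar < B10.pFun b₀ p₀ (S.gk k) ∧
        ∀ (μ : Hist S.P (k + 1) → GaugeField S.P (k + 1) G → Measure ((Fin d → ℤ) → ℝ))
          (Φ : Hist S.P (k + 1) → GaugeField S.P (k + 1) G → ((Fin d → ℤ) → ℝ) → (𝔖 k).Fl)
          (s : ℕ) (I J : Hist S.P (k + 1) → GaugeField S.P (k + 1) G → Finset (Fin d → ℤ))
          (a : Hist S.P (k + 1) → GaugeField S.P (k + 1) G → Coef d),
          (∀ h U, Measurable (Φ h U)) → (∀ h U, (𝔖 k).μ = (μ h U).map (Φ h U)) →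
          (∀ h, MeasurableSet ((𝔖 k).box h)) → (∀ h U, Measurable ((𝔖 k).𝒱 h U)) →
          (∀ h U, Φ h U ⁻¹' (𝔖 k).box h = smallFieldSet (I h U) (B10.pFun b₀ p₀ (S.gk k))) →
          (∀ h U z, (𝔖 k).𝒱 h U (Φ h U z) = hamiltonian s D ϰ (a h U) (J h U) z) →
          (∀ h U, coefSup s D (a h U) (J h U) ≤ c₀ * S.gk k ^ σ) →
          (∀ h U, ((I h U).card : ℝ) ≤ v * S.sites k) →
          (∀ h U, Real.exp (cumulantSum (μ h U) (hamiltonian s D ϰ (a h U) (J h U)) 𝔠.nbar -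
                ((I h U).card : ℝ) * errTerm Sc ρ₁ ρ₂ ρ₃ ρ₄ (coefSup s D (a h U) (J h U)) (B10.pFun b₀ p₀ (S.gk k)) 𝔠.nbar) ≤
              ∫ z, cutoffBoltzmann (hamiltonian s D ϰ (a h U) (J h U)) (I h U) (B10.pFun b₀ p₀ (S.gk k)) z ∂μ h U) →
          (∀ h U, ∫ z, cutoffBoltzmann (hamiltonian s D ϰ (a h U) (J h U)) (I h U) (B10.pFun b₀ p₀ (S.gk k)) z ∂μ h U ≤
              Real.exp (cumulantSum (μ h U) (hamiltonian s D ϰ (a h U) (J h U)) 𝔠.nbar +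
                ((I h U).card : ℝ) * errTerm Sc ρ₁ ρ₂ ρ₃ ρ₄ (coefSup s D (a h U) (J h U)) (B10.pFun b₀ p₀ (S.gk k)) 𝔠.nbar)) →
          ∀ h (U : GaugeField S.P (k + 1) G),
            Eq324 (∫ ω in (𝔖 k).box h, Real.exp ((𝔖 k).𝒱 h U ω) ∂(𝔖 k).μ)
              (fun n => cumulantOf (fun m => ∫ ω, (𝔖 k).𝒱 h U ω ^ m ∂(𝔖 k).μ) n) 𝔠.nbar (𝔠.Ca + 𝔠.Cc)
              ((L : ℝ) ^ k * S.g0sq) (3 + 𝔠.κ₀) (S.sites k) := by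
  obtain ⟨η₀, C, hη₀, hη₀1, hC, h⟩ :=
    eq324Row_of_sandwich_gk_vol 𝔠 (d := d) (D := D) (ϰ := ϰ) (bstar := bstar) (ρ₁ := ρ₁) (ρ₂ := ρ₂) (ρ₄ := ρ₄) hS hρ₃ hb₀ hp₀ hσ hc₀ hκσ
  refine ⟨η₀, C, hη₀, hη₀1, hC, fun S 𝔖 k v hgk hCv => ?_⟩
  obtain ⟨hb, hE⟩ := h S k v hgk hCv
  refine ⟨hb, fun μ Φ s I J a hΦ hμ hboxm hVm hbox hV hA hI hlow hup => ?_⟩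
  exact h324RowAt_freeLetter_of_latticePresentation 𝔊 𝔠 𝔖 k μ Φ hΦ hμ hboxm hVm I (fun _ _ => B10.pFun b₀ p₀ (S.gk k)) hbox
    (fun h U => hamiltonian s D ϰ (a h U) (J h U)) hV
    (fun h U => hE (μ h U) s (I h U) (J h U) (a h U) (hA h U) (hI h U) (hlow h U) (hup h U))

/-- **… WITH THE SANDWICH SUPPLIED IN KNIT FORM `∀ b > b*`** (the shape of the class Basic Lemma's hand-over: for every threshold above the free-field constant `b*`
both sides of (4.6)∣_{C = ∅} ∕ (4.7) hold): applied at `b := p(g_k)`, which (a) certifies exceeds `b*`.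
[cite: BenfattoEtAl1978, Lemma p.152 + b* p.159; Balaban1985UV3, (58) p.270; Balaban1982Higgs1, (3.24) p.616] -/
theorem exists_h324Row_freeLetter_of_classSandwich_of_forall_gt {D : ℕ} {ϰ bstar Sc ρ₁ ρ₂ ρ₃ ρ₄ b₀ p₀ σ c₀ : ℝ}
    (hS : 0 ≤ Sc) (hρ₃ : 0 < ρ₃) (hb₀ : 0 < b₀) (hp₀ : 2 / 3 < p₀) (hσ : 0 < σ) (hc₀ : 0 ≤ c₀) (hκσ : 6 + 2 * 𝔠.κ₀ < σ * (𝔠.nbar + 1)) :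
    ∃ η₀ C : ℝ, 0 < η₀ ∧ η₀ ≤ 1 ∧ 0 ≤ C ∧
      ∀ (S : Scales L) (𝔖 : ∀ k, StepSeries S G ↥(lieC 𝔊) (nblkOf S 𝔠.lane.carrier k) k) (k : ℕ) (v : ℝ),
        S.gk k ≤ η₀ → C * v ≤ 𝔠.Ca + 𝔠.Cc →
        ∀ (μ : Hist S.P (k + 1) → GaugeField S.P (k + 1) G → Measure ((Fin d → ℤ) → ℝ))
          (Φ : Hist S.P (k + 1) → GaugeField S.P (k + 1) G → ((Fin d → ℤ) → ℝ) → (𝔖 k).Fl)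
          (s : ℕ) (I J : Hist S.P (k + 1) → GaugeField S.P (k + 1) G → Finset (Fin d → ℤ))
          (a : Hist S.P (k + 1) → GaugeField S.P (k + 1) G → Coef d),
          (∀ h U, Measurable (Φ h U)) → (∀ h U, (𝔖 k).μ = (μ h U).map (Φ h U)) →
          (∀ h, MeasurableSet ((𝔖 k).box h)) → (∀ h U, Measurable ((𝔖 k).𝒱 h U)) →
          (∀ h U, Φ h U ⁻¹' (𝔖 k).box h = smallFieldSet (I h U) (B10.pFun b₀ p₀ (S.gk k))) →
          (∀ h U z, (𝔖 k).𝒱 h U (Φ h U z) = hamiltonian s D ϰ (a h U) (J h U) z) →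
          (∀ h U, coefSup s D (a h U) (J h U) ≤ c₀ * S.gk k ^ σ) →
          (∀ h U, ((I h U).card : ℝ) ≤ v * S.sites k) →
          (∀ h U (b : ℝ), bstar < b →
            Real.exp (cumulantSum (μ h U) (hamiltonian s D ϰ (a h U) (J h U)) 𝔠.nbar -
                  ((I h U).card : ℝ) * errTerm Sc ρ₁ ρ₂ ρ₃ ρ₄ (coefSup s D (a h U) (J h U)) b 𝔠.nbar) ≤
                ∫ z, cutoffBoltzmann (hamiltonian s D ϰ (a h U) (J h U)) (I h U) b z ∂μ h U ∧
              ∫ z, cutoffBoltzmann (hamiltonian s D ϰ (a h U) (J h U)) (I h U) b z ∂μ h U ≤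
                Real.exp (cumulantSum (μ h U) (hamiltonian s D ϰ (a h U) (J h U)) 𝔠.nbar +
                  ((I h U).card : ℝ) * errTerm Sc ρ₁ ρ₂ ρ₃ ρ₄ (coefSup s D (a h U) (J h U)) b 𝔠.nbar)) →
          ∀ h (U : GaugeField S.P (k + 1) G),
            Eq324 (∫ ω in (𝔖 k).box h, Real.exp ((𝔖 k).𝒱 h U ω) ∂(𝔖 k).μ)
              (fun n => cumulantOf (fun m => ∫ ω, (𝔖 k).𝒱 h U ω ^ m ∂(𝔖 k).μ) n) 𝔠.nbar (𝔠.Ca + 𝔠.Cc)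
              ((L : ℝ) ^ k * S.g0sq) (3 + 𝔠.κ₀) (S.sites k) := by
  obtain ⟨η₀, C, hη₀, hη₀1, hC, h⟩ :=
    exists_h324Row_freeLetter_of_classSandwich 𝔊 𝔠 (d := d) (D := D) (ϰ := ϰ) (bstar := bstar) (ρ₁ := ρ₁) (ρ₂ := ρ₂) (ρ₄ := ρ₄)
      hS hρ₃ hb₀ hp₀ hσ hc₀ hκσ
  refine ⟨η₀, C, hη₀, hη₀1, hC, fun S 𝔖 k v hgk hCv μ Φ s I J a hΦ hμ hboxm hVm hbox hV hA hI hknit => ?_⟩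
  obtain ⟨hb, hE⟩ := h S 𝔖 k v hgk hCv
  exact hE μ Φ s I J a hΦ hμ hboxm hVm hbox hV hA hI (fun h' U => (hknit h' U _ hb).1) (fun h' U => (hknit h' U _ hb).2)

/-- **… AT THE RECORD's OWN `b₀, p₀` AND PRINT's COUPLING POWER `σ = 1`** (threshold `B10.pFun 𝔠.b₀ 𝔠.p₀ (S.gk k)` as in the edition's `bound28`; coefficients `O(g_k)`;
`5 + 2κ₀ < n̄`), knit form of the sandwich. [cite: Balaban1985UV3, (7) p.257 + (41) p.266 + (56)–(58) p.270; Balaban1982Higgs1, (3.24) p.616; BenfattoEtAl1978, Lemma p.152] -/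
theorem exists_h324Row_freeLetter_of_classSandwich_rec_one {D : ℕ} {ϰ bstar Sc ρ₁ ρ₂ ρ₃ ρ₄ c₀ : ℝ}
    (hS : 0 ≤ Sc) (hρ₃ : 0 < ρ₃) (hc₀ : 0 ≤ c₀) (hn : 5 + 2 * 𝔠.κ₀ < 𝔠.nbar) :
    ∃ η₀ C : ℝ, 0 < η₀ ∧ η₀ ≤ 1 ∧ 0 ≤ C ∧
      ∀ (S : Scales L) (𝔖 : ∀ k, StepSeries S G ↥(lieC 𝔊) (nblkOf S 𝔠.lane.carrier k) k) (k : ℕ) (v : ℝ),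
        S.gk k ≤ η₀ → C * v ≤ 𝔠.Ca + 𝔠.Cc →
        ∀ (μ : Hist S.P (k + 1) → GaugeField S.P (k + 1) G → Measure ((Fin d → ℤ) → ℝ))
          (Φ : Hist S.P (k + 1) → GaugeField S.P (k + 1) G → ((Fin d → ℤ) → ℝ) → (𝔖 k).Fl)
          (s : ℕ) (I J : Hist S.P (k + 1) → GaugeField S.P (k + 1) G → Finset (Fin d → ℤ))
          (a : Hist S.P (k + 1) → GaugeField S.P (k + 1) G → Coef d),
          (∀ h U, Measurable (Φ h U)) → (∀ h U, (𝔖 k).μ = (μ h U).map (Φ h U)) →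
          (∀ h, MeasurableSet ((𝔖 k).box h)) → (∀ h U, Measurable ((𝔖 k).𝒱 h U)) →
          (∀ h U, Φ h U ⁻¹' (𝔖 k).box h = smallFieldSet (I h U) (B10.pFun 𝔠.b₀ 𝔠.p₀ (S.gk k))) →
          (∀ h U z, (𝔖 k).𝒱 h U (Φ h U z) = hamiltonian s D ϰ (a h U) (J h U) z) →
          (∀ h U, coefSup s D (a h U) (J h U) ≤ c₀ * S.gk k) →
          (∀ h U, ((I h U).card : ℝ) ≤ v * S.sites k) →
          (∀ h U (b : ℝ), bstar < b →
            Real.exp (cumulantSum (μ h U) (hamiltonian s D ϰ (a h U) (J h U)) 𝔠.nbar -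
                  ((I h U).card : ℝ) * errTerm Sc ρ₁ ρ₂ ρ₃ ρ₄ (coefSup s D (a h U) (J h U)) b 𝔠.nbar) ≤
                ∫ z, cutoffBoltzmann (hamiltonian s D ϰ (a h U) (J h U)) (I h U) b z ∂μ h U ∧
              ∫ z, cutoffBoltzmann (hamiltonian s D ϰ (a h U) (J h U)) (I h U) b z ∂μ h U ≤
                Real.exp (cumulantSum (μ h U) (hamiltonian s D ϰ (a h U) (J h U)) 𝔠.nbar +
                  ((I h U).card : ℝ) * errTerm Sc ρ₁ ρ₂ ρ₃ ρ₄ (coefSup s D (a h U) (J h U)) b 𝔠.nbar)) →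
          ∀ h (U : GaugeField S.P (k + 1) G),
            Eq324 (∫ ω in (𝔖 k).box h, Real.exp ((𝔖 k).𝒱 h U ω) ∂(𝔖 k).μ)
              (fun n => cumulantOf (fun m => ∫ ω, (𝔖 k).𝒱 h U ω ^ m ∂(𝔖 k).μ) n) 𝔠.nbar (𝔠.Ca + 𝔠.Cc)
              ((L : ℝ) ^ k * S.g0sq) (3 + 𝔠.κ₀) (S.sites k) := by
  obtain ⟨η₀, C, hη₀, hη₀1, hC, h⟩ :=
    exists_h324Row_freeLetter_of_classSandwich_of_forall_gt 𝔊 𝔠 (d := d) (D := D) (ϰ := ϰ) (bstar := bstar) (ρ₁ := ρ₁) (ρ₂ := ρ₂) (ρ₄ := ρ₄)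
      (b₀ := 𝔠.b₀) (p₀ := 𝔠.p₀) (σ := 1) hS hρ₃ 𝔠.b₀_pos (by linarith [𝔠.two_lt_p₀]) one_pos hc₀ (by linarith)
  refine ⟨η₀, C, hη₀, hη₀1, hC, fun S 𝔖 k v hgk hCv μ Φ s I J a hΦ hμ hboxm hVm hbox hV hA hI hknit => ?_⟩
  exact h S 𝔖 k v hgk hCv μ Φ s I J a hΦ hμ hboxm hVm hbox hV (fun h' U => by rw [Real.rpow_one]; exact hA h' U) hI hknit

end Plug

end Summit.QuantumFields.YangMills.Theorems.BalabanUVNodesN08AlphaEq324RowClassSocket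

end
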